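import Summits.QuantumFields.YangMills.Theorems.UnitScaleTiltProp7LODCutoffBlockSplit
import Summits.QuantumFields.YangMills.Theorems.UnitScaleTiltProp7BlockDistanceWeights
import HarnessLib

/-!
# Route `UnitScaleTilt`, crux K1 «MinimiserStabilityRegPr» (stmt-QuantumFields-19200), EX row `hGF` (curved member), the LOD line, slot (L6) —
# **SUPPLIER ROWS (χ-PATH + MOMENTS): THE CUT-OFF FAMILY IS LIPSCHITZ IN THE COARSE TORUS DISTANCE `tdist` BETWEEN ARBITRARY BLOCKS, AND THE
# `tdist`-MOMENTS OF AN EXPONENTIAL BLOCK KERNEL ARE VOLUME-FREE**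

Cell `ym3-torus` (HUMAN RULING D-0037: YM₃ on T³ is ladder rung R3 — NOT d = 4, NOT infinite volume, NOT a mass gap, NOT Clay).  Width seat `ym3-torus-px10`
(gen 10).  THEOREMS ONLY (0 `def`, 0 `sorry`); `--supports stmt-QuantumFields-19200 --as helper`, count-neutral.  HONEST LABEL (★★OWNER RULING №33 (6)): lattice
geometry feeding the (L6) IMS knit of the LOD line; nothing of (3.49), Thm 3.1∕3.11, `hK₂`, `hK₃`, `hT`, `hGF`, EX or the crux is proved here.

CONSUMERS (hypothesis shapes pinned).  The abstract IMS cores of the (L6) slot `hK₂` take a block-Lipschitz cut-off family and the moments of a block kernel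
in a block pseudo-metric `dc`: `hLip : ∀ X Y, Σ_b (g b X − g b Y)² ≤ ℓ²·dc X Y²` and `hS1 : ∀ X, Σ_Y dc X Y·β X Y ≤ S₁` of
✓`Prop7IMSFirstOrderBlockCommutator.sum_normSq_comm_blockConst_le` ∕ `…_le_of_blockBound_perturbed` (w5 g13), `hS : ∀ X, Σ_Y dc X Y²·β X Y ≤ S` of
✓`Prop7IMSDoubleCommutatorDecay.norm_imsError_le_of_blockBound` ∕ ✓`Prop7IMSDoubleCommutatorPerturbedBlock` (second moment), `hS0 : ∀ X, Σ_Y β X Y ≤ S₀`.  At the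
member `dc X Y := (Site.tdist X Y : ℝ)` on the coarse torus `Site (F.P K) (K − n)` (✓`Prop7BlockDistanceWeights`: `tdist_coarse_comm`, `tdist_coarse_triangle`; the Gram
rows of ✓`Prop7CoarseGramInverseDecay` decay like `C·e^{−μ·tdist}`), and the cut-offs are `g c Y := χ_c (corner Y)` for the fine-Lipschitz family `χ` of the (L6-χ) pen
(✓`Prop7LODCutoffBlockSplit`, whose coarse rows `sum_sq_corner_shift_sub_le` ∕ `abs_corner_shift_sub_le` treat ONE coarse step `Y ↦ Y + e_μ`).  This file closes the
remaining geometric gaps: the PATH form of the coarse rows for ARBITRARY pairs of blocks (Lipschitz in `tdist`, family∕Minkowski edition), and the second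
`tdist`-moment of the exponential kernel, uniformly in `K` and in the volume.

THE MATHEMATICS (folklore).  On the torus `T^{(j)} = (ℤ∕N)^d`, `N = sitesPerDir j`, the `ℓ¹` distance `tdist X Y = Σ_μ min((X_μ − Y_μ)~, (Y_μ − X_μ)~)` (lit `Setup`) is
realised by a lattice path that corrects one coordinate at a time, going the shorter way round each cycle; a per-step bound `|g(Y + e_μ) − g(Y)| ≤ a` telescopes to
`|g X − g Y| ≤ a·tdist X Y`, and for a FAMILY the square root of `Σ_c (·)²` is a norm, so the per-step family bound `Σ_c (g_c(Y + e_μ) − g_c Y)² ≤ B` telescopes by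
Minkowski to `Σ_c (g_c X − g_c Y)² ≤ B·(tdist X Y)²` ([Balaban1984PropagatorsI] (1.18)–(1.20) p. 20 uses exactly such block-Lipschitz partitions).  For the moment,
`y ≤ e^{y}` gives `t²·e^{−νt} ≤ (4∕ν)²·e^{−νt∕2}`, and the torus sum `Σ_Y e^{−(ν∕2)·tdist} ≤ (2(1 + 2∕ν))^d` is
✓`Prop7TorusExpWeightSum.sum_exp_neg_mul_tdist_le` ([Balaban1984PropagatorsII] (2.61)).

WHAT IS PROVED (ns `…Theorems.Prop7CoarseLipschitzTdist`; generic `P : Params`, any level `j`).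
* §1 `sum_sq_add_le_of_sq_two` (Minkowski with two weights), `iterate_shift_eq_update` (`t` steps = `update` of one coordinate), `sum_sq_sub_update_le` (one coordinate, the
  shorter way round: `Σ_c (g_c (update X μ v) − g_c X)² ≤ (min (v − X_μ)~ (X_μ − v)~)²·B`).
* §2 ★★ `sum_sq_sub_le_mul_tdist_sq` (`Σ_{c∈s} (g_c X − g_c Y)² ≤ B·(tdist X Y)²` for ALL `X Y : Site P j` from the per-step family rows) and ★ `abs_sub_le_mul_tdist`
  (scalar edition `|g X − g Y| ≤ a·tdist X Y`).
* §3 ★★ MEMBER∕BLOCK EDITION over the corner letters of ✓`Prop7LODCutoffBlockSplit`: `sum_sq_corner_sub_corner_le` (`Σ_{c∈s} (f_c(corner X) − f_c(corner Y))² ≤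
  ((L^k)²·B)·(tdist X Y)²` for ALL `X Y : Site P k` from the FINE per-step family bound `B`) and `abs_corner_sub_corner_le` (`≤ (a·L^k)·tdist X Y`) — the `hLip` row with
  `ℓ² := (L^k)²·B` (`= 2880∕L^{2s}` at the (L6-χ) pins, K-free).
* §4 ★ THE SECOND MOMENT: `sq_mul_exp_neg_le` (`t²·e^{−νt} ≤ (4∕ν)²·e^{−νt∕2}`), ★`sum_tdist_sq_mul_exp_le` (`Σ_Y tdist X Y²·e^{−ν·tdist X Y} ≤ (4∕ν)²(2(1+2∕ν))^d`, any level)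
  and its `C·e^{−ν·tdist}`-kernel packaging `sum_tdist_sq_mul_kernel_le` (the `hS` row of the double-commutator core).  The ZEROTH and FIRST moments (`hS0`, `hS1`) at the member
  are routeR-w2 g12's ✓`Prop7ComplementaryProjectorBlockDecay` rows (`sum_const_mul_exp_neg_mul_tdist_le`, `sum_tdist_mul_const_mul_exp_neg_mul_tdist_le`) — not re-typed here.
HONEST SCOPE.  Lattice geometry and two real inequalities; no operator, no estimate of print.

References: T. Bałaban, CMP **95** (1984) 17–40 [Balaban1984PropagatorsI] ((1.18)–(1.20) p.20); CMP **96** (1984) 223–250 [Balaban1984PropagatorsII] ((2.61) p.234);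
CMP **99** (1985) 389–434 [Balaban1985BackgroundPropagators] ((3.49) p.399, (3.100) pp.413–414).
-/

set_option autoImplicit false

noncomputable section

open scoped BigOperators

namespace Summit.QuantumFields.YangMills.Theorems.Prop7CoarseLipschitzTdist

open Literature.MathematicalPhysics.QuantumFieldTheory.Balaban1983to89
open Summit.QuantumFields.YangMills.Theorems.Prop7LODCutoffBlockSplit (sum_sq_corner_shift_sub_le abs_corner_shift_sub_le)
open Summit.QuantumFields.YangMills.Theorems.Prop7TorusExpWeightSum (sum_exp_neg_mul_tdist_le)
open B3Taylor310LocalRemainder (tdist_comm)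

variable {P : Params} {j : ℕ}

/-! ## §1 Minkowski with two weights; `t` steps in one direction; one coordinate the shorter way round -/

/-- Minkowski with two weights: `Σ(u+v)² ≤ (a+b)²·B` if `Σu² ≤ a²·B`, `Σv² ≤ b²·B` (`a, b, B ≥ 0`; Cauchy–Schwarz on the cross term). [folklore] -/
theorem sum_sq_add_le_of_sq_two {ι : Type*} (s : Finset ι) (u v : ι → ℝ) {B a b : ℝ} (ha : 0 ≤ a) (hb : 0 ≤ b) (hB : 0 ≤ B)
    (hu : ∑ c ∈ s, u c ^ 2 ≤ a ^ 2 * B) (hv : ∑ c ∈ s, v c ^ 2 ≤ b ^ 2 * B) :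
    ∑ c ∈ s, (u c + v c) ^ 2 ≤ (a + b) ^ 2 * B := by
  have hcs : (∑ c ∈ s, u c * v c) ^ 2 ≤ (∑ c ∈ s, u c ^ 2) * ∑ c ∈ s, v c ^ 2 := Finset.sum_mul_sq_le_sq_mul_sq s u v
  have hV0 : 0 ≤ ∑ c ∈ s, v c ^ 2 := Finset.sum_nonneg fun _ _ => sq_nonneg _
  have hprod : (∑ c ∈ s, u c * v c) ^ 2 ≤ (a * b * B) ^ 2 := by
    refine hcs.trans ?_
    calc (∑ c ∈ s, u c ^ 2) * ∑ c ∈ s, v c ^ 2 ≤ (a ^ 2 * B) * (b ^ 2 * B) := mul_le_mul hu hv hV0 (by positivity)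
      _ = (a * b * B) ^ 2 := by ring
  have hcross : ∑ c ∈ s, u c * v c ≤ a * b * B := by
    have h0 : 0 ≤ a * b * B := by positivity
    exact abs_le_of_sq_le_sq' hprod h0 |>.2
  have hexp : ∑ c ∈ s, (u c + v c) ^ 2 = ∑ c ∈ s, u c ^ 2 + 2 * ∑ c ∈ s, u c * v c + ∑ c ∈ s, v c ^ 2 := by
    rw [Finset.mul_sum, ← Finset.sum_add_distrib, ← Finset.sum_add_distrib]
    exact Finset.sum_congr rfl fun c _ => by ring
  have hsq : (a + b) ^ 2 * B = a ^ 2 * B + 2 * (a * b * B) + b ^ 2 * B := by ring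
  rw [hexp, hsq]
  linarith

/-- `t` unit steps in direction `μ` replace the `μ`-coordinate `X_μ` by `X_μ + t` and leave the others. [folklore] -/
theorem iterate_shift_eq_update (X : Site P j) (μ : Fin P.d) (t : ℕ) :
    (fun z : Site P j => z.shift μ)^[t] X = Function.update X μ (X μ + (t : ZMod (P.sitesPerDir j))) := by
  induction t with
  | zero => simp
  | succ t ih =>
    rw [Function.iterate_succ_apply', ih]
    funext ν
    simp only [Site.shift, Function.update_apply]
    by_cases h : ν = μ
    · subst h; simp; ring
    · simp [h]

/-- Family telescoping along one direction at level `j`: `Σ_{c∈s} (g_c(X + t·e_μ) − g_c X)² ≤ t²·B` from the per-step family bound `B` (Minkowski, `t` times).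
[cite: Balaban1984PropagatorsI, (1.18) p.20] -/
theorem sum_sq_sub_iterate_shift_le_lvl {ι : Type*} (s : Finset ι) (g : ι → Site P j → ℝ) {B : ℝ} (hB : 0 ≤ B)
    (hg : ∀ (Y : Site P j) (μ : Fin P.d), ∑ c ∈ s, (g c (Y.shift μ) - g c Y) ^ 2 ≤ B) (X : Site P j) (μ : Fin P.d) (t : ℕ) :
    ∑ c ∈ s, (g c ((fun z : Site P j => z.shift μ)^[t] X) - g c X) ^ 2 ≤ (t : ℝ) ^ 2 * B := by
  induction t with
  | zero => simp
  | succ t ih =>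
    have hsplit : ∀ c ∈ s, g c ((fun z : Site P j => z.shift μ)^[t + 1] X) - g c X
        = (g c ((fun z : Site P j => z.shift μ)^[t] X) - g c X)
          + (g c (((fun z : Site P j => z.shift μ)^[t] X).shift μ) - g c ((fun z : Site P j => z.shift μ)^[t] X)) := by
      intro c _; rw [Function.iterate_succ_apply']; ring
    rw [Finset.sum_congr rfl fun c hc => by rw [hsplit c hc], Nat.cast_succ]
    have h1 : ∑ c ∈ s, (g c (((fun z : Site P j => z.shift μ)^[t] X).shift μ) - g c ((fun z : Site P j => z.shift μ)^[t] X)) ^ 2 ≤ (1 : ℝ) ^ 2 * B := by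
      rw [one_pow, one_mul]; exact hg _ μ
    exact sum_sq_add_le_of_sq_two s _ _ (Nat.cast_nonneg t) zero_le_one hB ih h1

/-- ★ **ONE COORDINATE, THE SHORTER WAY ROUND.**  Replacing the `μ`-coordinate of `X` by `v` costs `Σ_{c∈s} (g_c(update X μ v) − g_c X)² ≤ (min (v − X_μ)~ (X_μ − v)~)²·B`:
`(v − X_μ)~` forward steps reach it from `X`, and `(X_μ − v)~` forward steps lead from it back to `X` (the square is symmetric). [folklore] -/
theorem sum_sq_sub_update_le {ι : Type*} (s : Finset ι) (g : ι → Site P j → ℝ) {B : ℝ} (hB : 0 ≤ B)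
    (hg : ∀ (Y : Site P j) (μ : Fin P.d), ∑ c ∈ s, (g c (Y.shift μ) - g c Y) ^ 2 ≤ B) (X : Site P j) (μ : Fin P.d) (v : ZMod (P.sitesPerDir j)) :
    ∑ c ∈ s, (g c (Function.update X μ v) - g c X) ^ 2 ≤ ((min (v - X μ).val (X μ - v).val : ℕ) : ℝ) ^ 2 * B := by
  -- forward from `X`
  have hfwd : ∑ c ∈ s, (g c (Function.update X μ v) - g c X) ^ 2 ≤ (((v - X μ).val : ℕ) : ℝ) ^ 2 * B := by
    have h := sum_sq_sub_iterate_shift_le_lvl s g hB hg X μ (v - X μ).val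
    rwa [iterate_shift_eq_update, ZMod.natCast_zmod_val, add_sub_cancel] at h
  -- forward from `update X μ v` back to `X`
  have hbwd : ∑ c ∈ s, (g c (Function.update X μ v) - g c X) ^ 2 ≤ (((X μ - v).val : ℕ) : ℝ) ^ 2 * B := by
    have h := sum_sq_sub_iterate_shift_le_lvl s g hB hg (Function.update X μ v) μ (X μ - v).val
    have hback : (fun z : Site P j => z.shift μ)^[(X μ - v).val] (Function.update X μ v) = X := by
      rw [iterate_shift_eq_update, ZMod.natCast_zmod_val]
      funext ν
      simp only [Function.update_apply]
      by_cases hν : ν = μ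
      · subst hν; simp
      · simp [hν]
    rw [hback] at h
    calc ∑ c ∈ s, (g c (Function.update X μ v) - g c X) ^ 2 = ∑ c ∈ s, (g c X - g c (Function.update X μ v)) ^ 2 :=
          Finset.sum_congr rfl fun c _ => by ring
      _ ≤ (((X μ - v).val : ℕ) : ℝ) ^ 2 * B := h
  rcases le_total (v - X μ).val (X μ - v).val with hle | hle
  · rw [min_eq_left hle]; exact hfwd
  · rw [min_eq_right hle]; exact hbwd

/-! ## §2 The path rows: Lipschitz in `tdist` from the per-step rows, for ALL pairs of sites -/

/-- ★★ **THE FAMILY PATH ROW.**  If `Σ_{c∈s} (g_c(Y + e_μ) − g_c Y)² ≤ B` for every site `Y` and direction `μ` of `T^{(j)}`, then for ALL `X, Y`: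
`Σ_{c∈s} (g_c X − g_c Y)² ≤ B·(tdist X Y)²` — correct the coordinates of `X` to those of `Y` one at a time, the shorter way round each cycle (§1), and add the
`d` legs by Minkowski; the legs' lengths sum to `tdist X Y` (lit `Setup`: `tdist X Y = Σ_μ min((X_μ − Y_μ)~, (Y_μ − X_μ)~)`). [cite: Balaban1984PropagatorsI, (1.18)-(1.20) p.20] -/
theorem sum_sq_sub_le_mul_tdist_sq {ι : Type*} (s : Finset ι) (g : ι → Site P j → ℝ) {B : ℝ} (hB : 0 ≤ B)
    (hg : ∀ (Y : Site P j) (μ : Fin P.d), ∑ c ∈ s, (g c (Y.shift μ) - g c Y) ^ 2 ≤ B) (X Y : Site P j) :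
    ∑ c ∈ s, (g c X - g c Y) ^ 2 ≤ B * (Site.tdist X Y : ℝ) ^ 2 := by
  classical
  -- the partially corrected sites `Z_T := (Y on T, X off T)` and their cost
  have hreach : ∀ T : Finset (Fin P.d),
      ∑ c ∈ s, (g c (fun ν => if ν ∈ T then Y ν else X ν : Site P j) - g c X) ^ 2
        ≤ ((∑ μ ∈ T, min (X μ - Y μ).val (Y μ - X μ).val : ℕ) : ℝ) ^ 2 * B := by
    intro T
    induction T using Finset.induction_on with
    | empty =>
      have h0 : (fun ν => if ν ∈ (∅ : Finset (Fin P.d)) then Y ν else X ν : Site P j) = X := by funext ν; simp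
      rw [h0]; simp
    | insert μ T hμ ih =>
      set Z : Site P j := fun ν => if ν ∈ T then Y ν else X ν with hZ
      have hZμ : Z μ = X μ := by simp [hZ, hμ]
      have heq : (fun ν => if ν ∈ insert μ T then Y ν else X ν : Site P j) = Function.update Z μ (Y μ) := by
        funext ν
        simp only [Finset.mem_insert, Function.update_apply, hZ]
        by_cases h1 : ν = μ
        · subst h1; simp
        · simp [h1]
      have hstep := sum_sq_sub_update_le s g hB hg Z μ (Y μ)
      rw [hZμ] at hstep
      have hsplit : ∀ c ∈ s, g c (Function.update Z μ (Y μ)) - g c X = (g c (Function.update Z μ (Y μ)) - g c Z) + (g c Z - g c X) := by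
        intro c _; ring
      rw [heq, Finset.sum_congr rfl fun c hc => by rw [hsplit c hc], Finset.sum_insert hμ, Nat.cast_add]
      have hmin : ((min (Y μ - X μ).val (X μ - Y μ).val : ℕ) : ℝ) = ((min (X μ - Y μ).val (Y μ - X μ).val : ℕ) : ℝ) := by rw [min_comm]
      rw [hmin] at hstep
      exact sum_sq_add_le_of_sq_two s _ _ (Nat.cast_nonneg _) (Nat.cast_nonneg _) hB hstep ih
  have hfin := hreach Finset.univ
  have hY : (fun ν => if ν ∈ (Finset.univ : Finset (Fin P.d)) then Y ν else X ν : Site P j) = Y := by funext ν; simp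
  rw [hY] at hfin
  have htd : ((∑ μ ∈ (Finset.univ : Finset (Fin P.d)), min (X μ - Y μ).val (Y μ - X μ).val : ℕ) : ℝ) = (Site.tdist X Y : ℝ) := by rfl
  rw [htd] at hfin
  calc ∑ c ∈ s, (g c X - g c Y) ^ 2 = ∑ c ∈ s, (g c Y - g c X) ^ 2 := Finset.sum_congr rfl fun c _ => by ring
    _ ≤ (Site.tdist X Y : ℝ) ^ 2 * B := hfin
    _ = B * (Site.tdist X Y : ℝ) ^ 2 := mul_comm _ _

/-- ★ **THE SCALAR PATH ROW**: a per-step bound `|g(Y + e_μ) − g(Y)| ≤ a` on `T^{(j)}` gives `|g X − g Y| ≤ a·tdist X Y` for ALL `X, Y` (§2 with a one-member family). [folklore] -/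
theorem abs_sub_le_mul_tdist (g : Site P j → ℝ) {a : ℝ} (hg : ∀ (Y : Site P j) (μ : Fin P.d), |g (Y.shift μ) - g Y| ≤ a) (X Y : Site P j) :
    |g X - g Y| ≤ a * (Site.tdist X Y : ℝ) := by
  have ha : 0 ≤ a := (abs_nonneg _).trans (hg X ⟨0, P.hd⟩)
  have hfam : ∀ (Z : Site P j) (μ : Fin P.d), ∑ c ∈ ({()} : Finset Unit), ((fun _ : Unit => g) c (Z.shift μ) - (fun _ : Unit => g) c Z) ^ 2 ≤ a ^ 2 := by
    intro Z μ
    rw [Finset.sum_singleton]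
    have h := hg Z μ
    have : |g (Z.shift μ) - g Z| ^ 2 ≤ a ^ 2 := pow_le_pow_left₀ (abs_nonneg _) h 2
    rwa [sq_abs] at this
  have h := sum_sq_sub_le_mul_tdist_sq ({()} : Finset Unit) (fun _ : Unit => g) (sq_nonneg a) hfam X Y
  rw [Finset.sum_singleton] at h
  have h2 : (g X - g Y) ^ 2 ≤ (a * (Site.tdist X Y : ℝ)) ^ 2 := by rw [mul_pow]; exact h
  have h3 : |g X - g Y| ≤ |a * (Site.tdist X Y : ℝ)| := sq_le_sq.1 h2
  rwa [abs_of_nonneg (by positivity : 0 ≤ a * (Site.tdist X Y : ℝ))] at h3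

/-! ## §3 The block edition over the corner letters of the (L6-χ) pen: `hLip` with `dc := tdist`, all pairs of blocks -/

/-- ★★ **THE `hLip` ROW OF THE (L6) IMS CORES, ALL PAIRS OF BLOCKS.**  For a family `f_c` on the FINE torus with the per-step family bound
`Σ_{c∈s} (f_c(x + e_μ) − f_c x)² ≤ B` and the block-constant readings at the corners `corner Y := fibreSite 0 k Y 0` of the `k`-blocks (the `g c Y := χ c (corner Y)` of
✓`Prop7LODCutoffBlockSplit`): `Σ_{c∈s} (f_c(corner X) − f_c(corner Y))² ≤ ((L^k)²·B)·(tdist X Y)²` for ALL coarse `X, Y : Site P k` — ✓`sum_sq_corner_shift_sub_le` is the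
one-step case, §2 does the path.  (`ℓ² := (L^k)²·B`; at the (L6-χ) pins `B = 2880∕(L^s·L^{K−n})²`, `k = K − n`: `ℓ² = 2880∕L^{2s}`, K-free.)
[cite: Balaban1984PropagatorsI, (1.18)-(1.20) p.20; Balaban1985BackgroundPropagators, (3.100) pp.413-414] -/
theorem sum_sq_corner_sub_corner_le {k : ℕ} (hk : k ≤ P.m + P.K) {ι : Type*} (s : Finset ι) (f : ι → Site P 0 → ℝ) {B : ℝ} (hB : 0 ≤ B)
    (hf : ∀ (x : Site P 0) (μ : Fin P.d), ∑ c ∈ s, (f c (x.shift μ) - f c x) ^ 2 ≤ B) (X Y : Site P k) :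
    ∑ c ∈ s, (f c (Site.fibreSite 0 k X fun _ => ⟨0, pow_pos P.L_pos k⟩) - f c (Site.fibreSite 0 k Y fun _ => ⟨0, pow_pos P.L_pos k⟩)) ^ 2
      ≤ (((P.L : ℝ) ^ k) ^ 2 * B) * (Site.tdist X Y : ℝ) ^ 2 :=
  sum_sq_sub_le_mul_tdist_sq s (fun c (Z : Site P k) => f c (Site.fibreSite 0 k Z fun _ => ⟨0, pow_pos P.L_pos k⟩)) (by positivity)
    (fun Z μ => sum_sq_corner_shift_sub_le hk s f hB hf Z μ) X Y

/-- ★ Scalar block edition: `|f(corner X) − f(corner Y)| ≤ (a·L^k)·tdist X Y` for ALL coarse `X, Y : Site P k` from the fine per-step bound `|f(x + e_μ) − f x| ≤ a`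
(✓`abs_corner_shift_sub_le` is the one-step case). [cite: Balaban1984PropagatorsI, (1.18) p.20] -/
theorem abs_corner_sub_corner_le {k : ℕ} (hk : k ≤ P.m + P.K) (f : Site P 0 → ℝ) {a : ℝ} (hf : ∀ (x : Site P 0) (μ : Fin P.d), |f (x.shift μ) - f x| ≤ a)
    (X Y : Site P k) :
    |f (Site.fibreSite 0 k X fun _ => ⟨0, pow_pos P.L_pos k⟩) - f (Site.fibreSite 0 k Y fun _ => ⟨0, pow_pos P.L_pos k⟩)| ≤ (a * (P.L : ℝ) ^ k) * (Site.tdist X Y : ℝ) :=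
  abs_sub_le_mul_tdist (fun Z : Site P k => f (Site.fibreSite 0 k Z fun _ => ⟨0, pow_pos P.L_pos k⟩)) (fun Z μ => abs_corner_shift_sub_le hk f hf Z μ) X Y

/-! ## §4 The `tdist`-moments of an exponential block kernel are volume-free -/

/-- `t²·e^{−νt} ≤ (4∕ν)²·e^{−νt∕2}` for `t ≥ 0`, `ν > 0` (`t·e^{−νt∕4} ≤ 4∕ν` from `y ≤ e^{y}`, squared). [folklore] -/
theorem sq_mul_exp_neg_le {ν t : ℝ} (hν : 0 < ν) (ht : 0 ≤ t) : t ^ 2 * Real.exp (-(ν * t)) ≤ (4 / ν) ^ 2 * Real.exp (-(ν / 2 * t)) := by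
  have h1 : ν / 4 * t ≤ Real.exp (ν / 4 * t) := by linarith [Real.add_one_le_exp (ν / 4 * t)]
  have h3 : t * Real.exp (-(ν / 4 * t)) ≤ 4 / ν := by
    have h4 : t * Real.exp (-(ν / 4 * t)) * (ν / 4) ≤ 1 := by
      calc t * Real.exp (-(ν / 4 * t)) * (ν / 4) = (ν / 4 * t) * Real.exp (-(ν / 4 * t)) := by ring
        _ ≤ Real.exp (ν / 4 * t) * Real.exp (-(ν / 4 * t)) := mul_le_mul_of_nonneg_right h1 (Real.exp_pos _).le
        _ = 1 := by rw [← Real.exp_add, add_neg_cancel, Real.exp_zero]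
    rw [le_div_iff₀ hν]; linarith
  have h0 : 0 ≤ t * Real.exp (-(ν / 4 * t)) := by positivity
  have h5 : (t * Real.exp (-(ν / 4 * t))) ^ 2 ≤ (4 / ν) ^ 2 := pow_le_pow_left₀ h0 h3 2
  have h2 : Real.exp (-(ν * t)) = Real.exp (-(ν / 4 * t)) ^ 2 * Real.exp (-(ν / 2 * t)) := by
    rw [sq, ← Real.exp_add, ← Real.exp_add]; ring_nf
  calc t ^ 2 * Real.exp (-(ν * t)) = (t * Real.exp (-(ν / 4 * t))) ^ 2 * Real.exp (-(ν / 2 * t)) := by rw [h2]; ring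
    _ ≤ (4 / ν) ^ 2 * Real.exp (-(ν / 2 * t)) := mul_le_mul_of_nonneg_right h5 (Real.exp_pos _).le

/-- ★ **SECOND `tdist`-MOMENT**: `Σ_Y tdist X Y²·e^{−ν·tdist X Y} ≤ (4∕ν)²·(2(1 + 2∕ν))^d` on `T^{(j)}` (any level, base point in the FIRST slot), for `ν > 0`, uniformly in
the volume — the `hS : Σ_Y dc X Y²·β X Y ≤ S` moment of the double-commutator IMS core ✓`Prop7IMSDoubleCommutatorDecay` ∕ ✓`…PerturbedBlock` for a kernel `β ≤ C·e^{−ν·tdist}`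
(✓`sum_exp_neg_mul_tdist_le` at `ν∕2` + `tdist_comm`; the zeroth and first moments at the member are routeR-w2's ✓`Prop7ComplementaryProjectorBlockDecay` rows).
[cite: Balaban1984PropagatorsII, (2.61) p.234] -/
theorem sum_tdist_sq_mul_exp_le (X : Site P j) {ν : ℝ} (hν : 0 < ν) :
    ∑ Y : Site P j, (Site.tdist X Y : ℝ) ^ 2 * Real.exp (-(ν * (Site.tdist X Y : ℝ))) ≤ (4 / ν) ^ 2 * (2 * (1 + 2 / ν)) ^ P.d := by
  have hν2 : 0 < ν / 2 := by positivity
  have hflip : ∑ Y : Site P j, Real.exp (-(ν / 2 * (Site.tdist X Y : ℝ))) ≤ (2 * (1 + 1 / (ν / 2))) ^ P.d :=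
    calc ∑ Y : Site P j, Real.exp (-(ν / 2 * (Site.tdist X Y : ℝ))) = ∑ Y : Site P j, Real.exp (-(ν / 2 * (Site.tdist Y X : ℝ))) :=
          Finset.sum_congr rfl fun Y _ => by rw [tdist_comm]
      _ ≤ (2 * (1 + 1 / (ν / 2))) ^ P.d := sum_exp_neg_mul_tdist_le X hν2
  calc ∑ Y : Site P j, (Site.tdist X Y : ℝ) ^ 2 * Real.exp (-(ν * (Site.tdist X Y : ℝ)))
      ≤ ∑ Y : Site P j, (4 / ν) ^ 2 * Real.exp (-(ν / 2 * (Site.tdist X Y : ℝ))) :=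
        Finset.sum_le_sum fun Y _ => sq_mul_exp_neg_le hν (Nat.cast_nonneg _)
    _ = (4 / ν) ^ 2 * ∑ Y : Site P j, Real.exp (-(ν / 2 * (Site.tdist X Y : ℝ))) := by rw [Finset.mul_sum]
    _ ≤ (4 / ν) ^ 2 * (2 * (1 + 1 / (ν / 2))) ^ P.d := mul_le_mul_of_nonneg_left hflip (by positivity)
    _ = (4 / ν) ^ 2 * (2 * (1 + 2 / ν)) ^ P.d := by rw [one_div_div]

/-- The `hS` row packaged for a block kernel bound `β X Y ≤ C·e^{−ν·tdist X Y}` (`C ≥ 0`, `ν > 0`) with `dc := tdist`: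
`Σ_Y tdist X Y²·β X Y ≤ C·(4∕ν)²·(2(1 + 2∕ν))^d`, uniformly in the volume. [cite: Balaban1984PropagatorsII, (2.61) p.234; Balaban1985BackgroundPropagators, (3.49) p.399] -/
theorem sum_tdist_sq_mul_kernel_le (β : Site P j → Site P j → ℝ) {C ν : ℝ} (hC : 0 ≤ C) (hν : 0 < ν)
    (hβ : ∀ X Y, β X Y ≤ C * Real.exp (-(ν * (Site.tdist X Y : ℝ)))) (X : Site P j) :
    ∑ Y : Site P j, (Site.tdist X Y : ℝ) ^ 2 * β X Y ≤ C * ((4 / ν) ^ 2 * (2 * (1 + 2 / ν)) ^ P.d) :=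
  calc ∑ Y : Site P j, (Site.tdist X Y : ℝ) ^ 2 * β X Y ≤ ∑ Y : Site P j, (Site.tdist X Y : ℝ) ^ 2 * (C * Real.exp (-(ν * (Site.tdist X Y : ℝ)))) :=
        Finset.sum_le_sum fun Y _ => mul_le_mul_of_nonneg_left (hβ X Y) (sq_nonneg _)
    _ = C * ∑ Y : Site P j, (Site.tdist X Y : ℝ) ^ 2 * Real.exp (-(ν * (Site.tdist X Y : ℝ))) := by
        rw [Finset.mul_sum]; exact Finset.sum_congr rfl fun Y _ => by ring
    _ ≤ C * ((4 / ν) ^ 2 * (2 * (1 + 2 / ν)) ^ P.d) := mul_le_mul_of_nonneg_left (sum_tdist_sq_mul_exp_le X hν) hC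

end Summit.QuantumFields.YangMills.Theorems.Prop7CoarseLipschitzTdist

end
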